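import Summits.AtomisticToContinuum.HydrodynamicLimit.Theses.TwoClocks

/-!
# Sketch — crux idea `tagged-count-chernoff` for crux `TransferActivityTails`
(stmt-AtomisticToContinuum-16624, route TwoClocks)

First lemmas of the line, stated over existing declarations (crux-ideate stage: they must
ELABORATE; proofs are not required).  The transfer target `TaggedCountChernoff` (exponential
upper tails of ONE tagged sphere's energy-marked, impulse-truncated window collision count under
the true pre-shock law) and the two lemmas reducing the crux to it BY NAME:
`transfer_le_hitWeight` (per-record kinematics from momentum + energy conservation alone) and
`transferActivityTails_of_taggedCountChernoff` (layer-cake).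
-/

noncomputable section

namespace Summit.AtomisticToContinuum.HydrodynamicLimit.Cruxes.TransferActivityTails.TaggedCountChernoff

open scoped BigOperators Topology Classical MeasureTheory ENNReal InnerProductSpace
open MeasureTheory Set Filter
open Literature.MathematicalPhysics.KineticTheory Literature.Analysis.FluidPDE

/-- The hard-sphere flows of the crux: `N+1` spheres of diameter `hsDiameter σ N` on `𝕋³`. -/
abbrev Flow (σ : ℝ) (N : ℕ) :=
  HardSphereFlow (Torus.geometry (Fin 3)) (hsDiameter σ N) (N + 1)

/-- Configurations of `N+1` spheres on `𝕋³`. -/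
abbrev Cfg (N : ℕ) := Config (N + 1) (Fin 3) T3

/-- The crux window `w_N = τ (N+1)^{-1/3}`. -/
def window (τ : ℝ) (N : ℕ) : ℝ := τ * ((N : ℝ) + 1) ^ (-(1 / 3 : ℝ))

/-- The crux's per-record TRANSFER weight of particle `i` (momentum impulse + energy impulse):
`‖v_i⁺ - v_i⁻‖ + |‖v_i⁺‖² - ‖v_i⁻‖²| / 2` on records whose first partner is `i`. -/
def transferWeight {N : ℕ} (i : Fin (N + 1)) (c : HardSphereCollisionRecord (Fin 3) T3 (N + 1)) : ℝ :=
  if c.fst = i then ‖c.postVel.1 - c.preVel.1‖ + |‖c.postVel.1‖ ^ 2 - ‖c.preVel.1‖ ^ 2| / 2 else 0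

/-- The ENERGY-MARKED, IMPULSE-TRUNCATED hit weight of particle `i`:
`2 (1 + ‖v_i⁻‖² + ‖v_j⁻‖²) · min 1 ‖v_i⁺ - v_i⁻‖` — a grazing collision counts its impulse, a
significant one counts `1`, each marked by the pre-collisional kinetic energies of the pair. -/
def hitWeight {N : ℕ} (i : Fin (N + 1)) (c : HardSphereCollisionRecord (Fin 3) T3 (N + 1)) : ℝ :=
  if c.fst = i then 2 * (1 + ‖c.preVel.1‖ ^ 2 + ‖c.preVel.2‖ ^ 2) * min 1 ‖c.postVel.1 - c.preVel.1‖
  else 0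

/-- The crux's window transfer activity `a_i(s) = (σ/τ) Σ_{hits of i in (s, s+w]} transferWeight`. -/
def act {σ : ℝ} {N : ℕ} (Φ : Flow σ N) (τ s : ℝ) (i : Fin (N + 1)) (z : Cfg N) : ℝ :=
  σ / τ * Φ.collisionSum (Set.Ioc s (s + window τ N)) (transferWeight i) z

/-- The tagged sphere's weighted window COUNT `W_i(s) = Σ_{hits of i in (s, s+w]} hitWeight`. -/
def weightedCount {σ : ℝ} {N : ℕ} (Φ : Flow σ N) (τ s : ℝ) (i : Fin (N + 1)) (z : Cfg N) : ℝ :=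
  Φ.collisionSum (Set.Ioc s (s + window τ N)) (hitWeight i) z

/-- **FIRST LEMMA (per-record kinematics).**  If `δ = v⁺ - v⁻` is the velocity jump of one partner
of a binary collision with partner pre-velocity `w`, momentum and energy conservation ALONE give
`‖δ‖² = ⟪w - v, δ⟫` (hence `‖δ‖ ≤ ‖w - v‖` and `‖v + δ‖² - ‖v‖² = ⟪v + w, δ⟫`), and then
transfer weight ≤ hit weight:
`‖δ‖ + |‖v+δ‖² - ‖v‖²|/2 ≤ 2 (1 + ‖v‖² + ‖w‖²) · min 1 ‖δ‖`. -/
theorem transfer_le_hitWeight (v w δ : V3) (h : ‖δ‖ ^ 2 = ⟪w - v, δ⟫_ℝ) :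
    ‖δ‖ + |‖v + δ‖ ^ 2 - ‖v‖ ^ 2| / 2 ≤ 2 * (1 + ‖v‖ ^ 2 + ‖w‖ ^ 2) * min 1 ‖δ‖ := by
  sorry

/-- The records of `collisionSum` are read off configurations by `ofConfig`, whose pre-velocities
are `reflectVel (sepVec)` of the post-velocities; momentum (`reflectVel_fst_add_reflectVel_snd`) and
energy (`norm_sq_reflectVel_fst_add_norm_sq_reflectVel_snd`) conservation give the hypothesis of
`transfer_le_hitWeight`, hence PATHWISE, for every datum `z` and every `i`:
`transferWeight i c ≤ hitWeight i c` on every such record. -/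
theorem transferWeight_ofConfig_le_hitWeight {N : ℕ} (ε : ℝ) (z : Cfg N) (t : ℝ) (i k l : Fin (N + 1)) :
    transferWeight i (HardSphereCollisionRecord.ofConfig (Torus.geometry (Fin 3)) ε z t k l) ≤
      hitWeight i (HardSphereCollisionRecord.ofConfig (Torus.geometry (Fin 3)) ε z t k l) := by
  sorry

/-- Consequence (pathwise domination of the crux functional by the weighted count):
`a_i(s) ≤ (σ/τ) · W_i(s)` for `0 ≤ σ/τ`, every flow, datum, window and tagged index — the
collision sums being finite sums over the same records (or both junk `0`). -/
theorem act_le_weightedCount {σ : ℝ} {N : ℕ} (hστ : 0 ≤ σ) (Φ : Flow σ N) {τ : ℝ} (hτ : 0 < τ)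
    (s : ℝ) (i : Fin (N + 1)) (z : Cfg N) :
    act Φ τ s i z ≤ σ / τ * weightedCount Φ τ s i z := by
  sorry

/-- **TRANSFER TARGET `C⁺` — TAGGED COUNT CHERNOFF BOUND.**  In the crux's frame (continuous
profiles, `σ < σ₀`, classical hs-Euler solution on `[0,T)` tied to the data by the `t = 0` LLN,
every flow family, `t < T`): there are a level `V₀ > 0` and RATE constants `c, C > 0` (chosen
BEFORE `τ`) such that for all `τ ≥ τ₀`, `N ≥ N₀(τ)`, `s ∈ [0,t]`, every tagged index `i` and every
count level `x ≥ V₀ τ / σ`, the true law gives the tagged weighted window count an exponential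
upper tail `P(W_i(s) ≥ x) ≤ C e^{-c x}` (plus a.e.-measurability of `W_i(s)`).  The scale
`V₀ τ/σ` is a fixed multiple of the MEAN count (`≍ τ σ² √θ` hits of weight `O(1+θ)`): this is a
Chernoff / upper-large-deviation bound IN THE COUNT for ONE sphere, not an extensive statement. -/
def TaggedCountChernoff : Prop :=
  ∀ (a₀ θ₀ : T3 → ℝ) (u₀ : T3 → V3), Continuous a₀ → Continuous θ₀ → Continuous u₀ →
    (∀ x, 0 < a₀ x) → (∀ x, 0 < θ₀ x) → ∃ σ₀ : ℝ, 0 < σ₀ ∧ ∀ σ : ℝ, 0 < σ → σ < σ₀ →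
    ∀ (T : ℝ) (ρ θ : ℝ → T3 → ℝ) (u : ℝ → T3 → V3), IsHardSphereEulerSolution σ T ρ u θ →
    ∀ Φ : (N : ℕ) → Flow σ N,
    TendstoHydroFieldsAt (fun N => localGibbsLaw σ a₀ u₀ θ₀ N (Φ N)) Φ ρ u θ 0 →
    ∀ t ∈ Set.Ico 0 T, ∃ V₀ : ℝ, 0 < V₀ ∧ ∃ c : ℝ, 0 < c ∧ ∃ C : ℝ, 0 < C ∧
    ∃ τ₀ : ℝ, 0 < τ₀ ∧ ∀ τ : ℝ, τ₀ ≤ τ → ∃ N₀ : ℕ, ∀ N : ℕ, N₀ ≤ N → ∀ s ∈ Set.Icc 0 t,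
    ∀ i : Fin (N + 1),
      AEMeasurable (weightedCount (Φ N) τ s i) (localGibbsLaw σ a₀ u₀ θ₀ N (Φ N)) ∧
      ∀ x : ℝ, V₀ * τ / σ ≤ x →
        localGibbsLaw σ a₀ u₀ θ₀ N (Φ N) {z | x ≤ weightedCount (Φ N) τ s i z} ≤
          ENNReal.ofReal (C * Real.exp (-(c * x)))

/-- **COMPOSITION (the line concludes the crux BY NAME).**  Layer-cake under `P`:
`E[a_i 𝟙{a_i > V}] ≤ (σ/τ) E[W_i 𝟙{W_i > Vτ/σ}] ≤ (σ/τ)·C (Vτ/σ + 1/c) e^{-cVτ/σ}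
 = C (V + σ/(cτ)) e^{-cVτ/σ}` for `V ≥ V₀`, which is `≤ ε` once `τ ≥ τ₁(ε,V,c,C,σ)`; average over
`i`; both halves of the crux shape (UI and fixed-level fraction, Disproof §7a of the predecessor
crux) come out of the one tail bound. -/
theorem transferActivityTails_of_taggedCountChernoff (h : TaggedCountChernoff) :
    Summit.AtomisticToContinuum.HydrodynamicLimit.Theses.TwoClocks.TransferActivityTails := by
  sorry

/-- Sanity: the crux's own `act` (verbatim `let` of the route decl) is this file's `act`. -/
example {σ : ℝ} {N : ℕ} (Φ : Flow σ N) (τ s : ℝ) (i : Fin (N + 1)) (z : Cfg N) :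
    act Φ τ s i z = σ / τ * (Φ).collisionSum (Set.Ioc s (s + τ * ((N : ℝ) + 1) ^ (-(1 / 3 : ℝ))))
      (fun c => if c.fst = i then ‖c.postVel.1 - c.preVel.1‖ + |‖c.postVel.1‖ ^ 2 - ‖c.preVel.1‖ ^ 2| / 2
        else 0) z := by
  rfl

end Summit.AtomisticToContinuum.HydrodynamicLimit.Cruxes.TransferActivityTails.TaggedCountChernoff
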